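import Literature.Topology.FourManifolds.FishtailTubeALocal
import HarnessLib

/-!
# The tube about the path from the collar annulus to the box

Infrastructure for the explicit fishtail neighbourhood (R. Gompf, *More Cappell–Shaneson spheres
are standard*, Algebr. Geom. Topol. 10 (2010), proof of Thm 2.1 (the collar `[1, 2] × ∂F` joining
`F` to the box `N`) and Lemma 2.2; the named fact
`Literature.Topology.FourManifolds.gompf2010_framedTwist`). Between the vertical segment over the
puncture and the hole `γ` in the face of the box, Gompf's disc is the product of a planar path in
the `(t, y)`-plane (vertical side, quarter bend, horizontal leg) with the fibre circle, at the
latitude `n = n_j`. Its tube is the affine image of the planar shells of `FishtailProfile.lean`: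
with the offset `(a, b)` rotated by the fibre angle,
`(ã, b̃) = (-(a sin ℓ + b cos ℓ), a cos ℓ - b sin ℓ)` (so that `b̃ + i(-ã) = (a + ib) e^{iℓ}`),
the tube point is `(n, y, ℓ, t) = (n_j + b̃, y_h - Y, ℓ, t₀ + X)`, `(X, Y) = F(pos, ã)` for a planar
shell `F`.

* `Literature.Topology.FourManifolds.rotAB`, `Literature.Topology.FourManifolds.pathTubeMap F n_j y_h t₀`;
* `Literature.Topology.FourManifolds.isLocalDiffeomorphAt_pathTubeMap` — a local diffeomorphism
  wherever the shell `F` has nonvanishing planar Jacobian (the rotation, the graph of `F` over the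
  carried `(ℓ, b̃)`, and an affine map);
* `Literature.Topology.FourManifolds.pathTubeMap_inj` — injectivity from injectivity of the shell.

Everything is proved; no named facts.

## References

* R. E. Gompf, *More Cappell–Shaneson spheres are standard*, Algebr. Geom. Topol. 10 (2010)
  1665–1681, proof of Thm 2.1 and Lemma 2.2. [GompfAGT2010]
-/

noncomputable section

open scoped Real ContDiff Topology Manifold
open Set Function Filter

namespace Literature.Topology.FourManifolds

section Path

/-- **The rotated offset** `(ã, b̃) = (-(a sin ℓ + b cos ℓ), a cos ℓ - b sin ℓ)`. [folklore] -/
def rotAB (ℓ a b : ℝ) : ℝ × ℝ := (-(a * Real.sin ℓ + b * Real.cos ℓ), a * Real.cos ℓ - b * Real.sin ℓ)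

/-- The inverse rotation. [folklore] -/
def rotABInv (ℓ : ℝ) (p : ℝ × ℝ) : ℝ × ℝ :=
  (-(p.1 * Real.sin ℓ) + p.2 * Real.cos ℓ, -(p.1 * Real.cos ℓ) - p.2 * Real.sin ℓ)

/-- `rotABInv ∘ rotAB = id`. [folklore] -/
theorem rotABInv_rotAB (ℓ a b : ℝ) : rotABInv ℓ (rotAB ℓ a b) = (a, b) := by
  simp only [rotABInv, rotAB]
  refine Prod.ext ?_ ?_
  · simp only
    linear_combination a * Real.sin_sq_add_cos_sq ℓ
  · simp only
    linear_combination b * Real.sin_sq_add_cos_sq ℓ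

/-- `rotAB ∘ rotABInv = id`. [folklore] -/
theorem rotAB_rotABInv (ℓ : ℝ) (p : ℝ × ℝ) : rotAB ℓ (rotABInv ℓ p).1 (rotABInv ℓ p).2 = p := by
  simp only [rotABInv, rotAB]
  refine Prod.ext ?_ ?_
  · simp only
    linear_combination p.1 * Real.sin_sq_add_cos_sq ℓ
  · simp only
    linear_combination p.2 * Real.sin_sq_add_cos_sq ℓ

/-- The rotation as a diffeomorphism of `ℝ⁴`: `(pos, ℓ, a, b) ↦ ((ℓ, b̃), (pos, ã))`. [folklore] -/
def pathRot : (ℝ × ℝ × ℝ × ℝ) ≃ₘ⟮𝓘(ℝ, ℝ × ℝ × ℝ × ℝ), 𝓘(ℝ, (ℝ × ℝ) × (ℝ × ℝ))⟯ ((ℝ × ℝ) × (ℝ × ℝ)) where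
  toFun q := ((q.2.1, (rotAB q.2.1 q.2.2.1 q.2.2.2).2), (q.1, (rotAB q.2.1 q.2.2.1 q.2.2.2).1))
  invFun p := (p.2.1, p.1.1, (rotABInv p.1.1 (p.2.2, p.1.2)).1, (rotABInv p.1.1 (p.2.2, p.1.2)).2)
  left_inv q := by
    obtain ⟨pos, ℓ, a, b⟩ := q
    have h := rotABInv_rotAB ℓ a b
    simp only
    rw [show ((rotAB ℓ a b).1, (rotAB ℓ a b).2) = rotAB ℓ a b from rfl, h]
  right_inv p := by
    obtain ⟨⟨ℓ, bt⟩, pos, at'⟩ := p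
    have h := rotAB_rotABInv ℓ (at', bt)
    simp only [h]
  contMDiff_toFun := by
    refine contMDiff_iff_contDiff.2 ?_
    have h1 : ContDiff ℝ ∞ fun q : ℝ × ℝ × ℝ × ℝ ↦ q.1 := contDiff_fst
    have h2 : ContDiff ℝ ∞ fun q : ℝ × ℝ × ℝ × ℝ ↦ q.2.1 := contDiff_fst.comp contDiff_snd
    have h3 : ContDiff ℝ ∞ fun q : ℝ × ℝ × ℝ × ℝ ↦ q.2.2.1 := contDiff_fst.comp (contDiff_snd.comp contDiff_snd)
    have h4 : ContDiff ℝ ∞ fun q : ℝ × ℝ × ℝ × ℝ ↦ q.2.2.2 := contDiff_snd.comp (contDiff_snd.comp contDiff_snd)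
    have hs : ContDiff ℝ ∞ fun q : ℝ × ℝ × ℝ × ℝ ↦ Real.sin q.2.1 := Real.contDiff_sin.comp h2
    have hc : ContDiff ℝ ∞ fun q : ℝ × ℝ × ℝ × ℝ ↦ Real.cos q.2.1 := Real.contDiff_cos.comp h2
    refine (h2.prodMk ((h3.mul hc).sub (h4.mul hs))).prodMk (h1.prodMk ((h3.mul hs).add (h4.mul hc)).neg)
  contMDiff_invFun := by
    refine contMDiff_iff_contDiff.2 ?_
    have h1 : ContDiff ℝ ∞ fun p : (ℝ × ℝ) × (ℝ × ℝ) ↦ p.1.1 := contDiff_fst.comp contDiff_fst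
    have h2 : ContDiff ℝ ∞ fun p : (ℝ × ℝ) × (ℝ × ℝ) ↦ p.1.2 := contDiff_snd.comp contDiff_fst
    have h3 : ContDiff ℝ ∞ fun p : (ℝ × ℝ) × (ℝ × ℝ) ↦ p.2.1 := contDiff_fst.comp contDiff_snd
    have h4 : ContDiff ℝ ∞ fun p : (ℝ × ℝ) × (ℝ × ℝ) ↦ p.2.2 := contDiff_snd.comp contDiff_snd
    have hs : ContDiff ℝ ∞ fun p : (ℝ × ℝ) × (ℝ × ℝ) ↦ Real.sin p.1.1 := Real.contDiff_sin.comp h1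
    have hc : ContDiff ℝ ∞ fun p : (ℝ × ℝ) × (ℝ × ℝ) ↦ Real.cos p.1.1 := Real.contDiff_cos.comp h1
    exact h3.prodMk (h1.prodMk (((h4.mul hs).neg.add (h2.mul hc)).prodMk ((h4.mul hc).neg.sub (h2.mul hs))))

/-- The value of `pathRot`. [folklore] -/
@[simp] theorem pathRot_apply (q : ℝ × ℝ × ℝ × ℝ) :
    pathRot q = ((q.2.1, (rotAB q.2.1 q.2.2.1 q.2.2.2).2), (q.1, (rotAB q.2.1 q.2.2.1 q.2.2.2).1)) := rfl

variable (F : ℝ × ℝ → ℝ × ℝ) (nj yh t₀ : ℝ)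

/-- **The tube about the path**: `(pos, ℓ, a, b) ↦ (n, y, ℓ, t) = (n_j + b̃, y_h - Y, ℓ, t₀ + X)`,
`(X, Y) = F(pos, ã)`. [cite: GompfAGT2010, Thm 2.1 (proof: the collar [1,2] × ∂F joining F to N)] -/
def pathTubeMap (q : ℝ × ℝ × ℝ × ℝ) : ℝ × ℝ × ℝ × ℝ :=
  (nj + (rotAB q.2.1 q.2.2.1 q.2.2.2).2, yh - (F (q.1, (rotAB q.2.1 q.2.2.1 q.2.2.2).1)).2, q.2.1,
    t₀ + (F (q.1, (rotAB q.2.1 q.2.2.1 q.2.2.2).1)).1)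

/-- The affine output map `((ℓ, b̃), (X, Y)) ↦ (n_j + b̃, y_h - Y, ℓ, t₀ + X)`, a diffeomorphism. [folklore] -/
def pathOut : ((ℝ × ℝ) × (ℝ × ℝ)) ≃ₘ⟮𝓘(ℝ, (ℝ × ℝ) × (ℝ × ℝ)), 𝓘(ℝ, ℝ × ℝ × ℝ × ℝ)⟯ (ℝ × ℝ × ℝ × ℝ) where
  toFun p := (nj + p.1.2, yh - p.2.2, p.1.1, t₀ + p.2.1)
  invFun r := ((r.2.2.1, r.1 - nj), (r.2.2.2 - t₀, yh - r.2.1))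
  left_inv p := by
    obtain ⟨⟨ℓ, bt⟩, X, Y⟩ := p
    simp
  right_inv r := by
    obtain ⟨n, y, ℓ, t⟩ := r
    simp
  contMDiff_toFun := by
    refine contMDiff_iff_contDiff.2 ?_
    have h1 : ContDiff ℝ ∞ fun p : (ℝ × ℝ) × (ℝ × ℝ) ↦ p.1.1 := contDiff_fst.comp contDiff_fst
    have h2 : ContDiff ℝ ∞ fun p : (ℝ × ℝ) × (ℝ × ℝ) ↦ p.1.2 := contDiff_snd.comp contDiff_fst
    have h3 : ContDiff ℝ ∞ fun p : (ℝ × ℝ) × (ℝ × ℝ) ↦ p.2.1 := contDiff_fst.comp contDiff_snd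
    have h4 : ContDiff ℝ ∞ fun p : (ℝ × ℝ) × (ℝ × ℝ) ↦ p.2.2 := contDiff_snd.comp contDiff_snd
    exact (contDiff_const.add h2).prodMk ((contDiff_const.sub h4).prodMk (h1.prodMk (contDiff_const.add h3)))
  contMDiff_invFun := by
    refine contMDiff_iff_contDiff.2 ?_
    have h1 : ContDiff ℝ ∞ fun q : ℝ × ℝ × ℝ × ℝ ↦ q.1 := contDiff_fst
    have h2 : ContDiff ℝ ∞ fun q : ℝ × ℝ × ℝ × ℝ ↦ q.2.1 := contDiff_fst.comp contDiff_snd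
    have h3 : ContDiff ℝ ∞ fun q : ℝ × ℝ × ℝ × ℝ ↦ q.2.2.1 := contDiff_fst.comp (contDiff_snd.comp contDiff_snd)
    have h4 : ContDiff ℝ ∞ fun q : ℝ × ℝ × ℝ × ℝ ↦ q.2.2.2 := contDiff_snd.comp (contDiff_snd.comp contDiff_snd)
    exact (h3.prodMk (h1.sub contDiff_const)).prodMk ((h4.sub contDiff_const).prodMk (contDiff_const.sub h2))

variable {F nj yh t₀}

/-- The tube factors: `pathTubeMap = pathOut ∘ (graph of F over (ℓ, b̃)) ∘ pathRot`. [folklore] -/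
theorem pathTubeMap_eq (q : ℝ × ℝ × ℝ × ℝ) :
    pathTubeMap F nj yh t₀ q = pathOut nj yh t₀ ((pathRot q).1, F (pathRot q).2) := rfl

/-- **The tube about the path is a local diffeomorphism** at `(pos, ℓ, a, b)` as soon as the shell
`F` is smooth near `(pos, ã)` with partial derivatives of nonzero determinant there. [folklore] -/
theorem isLocalDiffeomorphAt_pathTubeMap {U : Set (ℝ × ℝ)} (hU : IsOpen U) (hF : ContDiffOn ℝ ∞ F U)
    {q : ℝ × ℝ × ℝ × ℝ} (hq : (q.1, (rotAB q.2.1 q.2.2.1 q.2.2.2).1) ∈ U) {u v : ℝ × ℝ}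
    (hu : HasDerivAt (fun x ↦ F (x, (rotAB q.2.1 q.2.2.1 q.2.2.2).1)) u q.1)
    (hv : HasDerivAt (fun a ↦ F (q.1, a)) v (rotAB q.2.1 q.2.2.1 q.2.2.2).1)
    (hD : u.1 * v.2 - u.2 * v.1 ≠ 0) :
    IsLocalDiffeomorphAt 𝓘(ℝ, ℝ × ℝ × ℝ × ℝ) 𝓘(ℝ, ℝ × ℝ × ℝ × ℝ) ∞ (pathTubeMap F nj yh t₀) q := by
  have h1 : IsLocalDiffeomorphAt 𝓘(ℝ, ℝ × ℝ × ℝ × ℝ) 𝓘(ℝ, (ℝ × ℝ) × (ℝ × ℝ)) ∞ pathRot q := pathRot.isLocalDiffeomorph q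
  have h2 : IsLocalDiffeomorphAt 𝓘(ℝ, (ℝ × ℝ) × (ℝ × ℝ)) 𝓘(ℝ, (ℝ × ℝ) × (ℝ × ℝ)) ∞
      (fun p : (ℝ × ℝ) × (ℝ × ℝ) ↦ (p.1, F p.2)) (pathRot q) := by
    have hU' : IsOpen {p : (ℝ × ℝ) × (ℝ × ℝ) | p.2 ∈ U} := hU.preimage continuous_snd
    have hf : ContDiffOn ℝ ∞ (fun p : (ℝ × ℝ) × (ℝ × ℝ) ↦ F p.2) {p | p.2 ∈ U} :=
      hF.comp contDiffOn_snd fun p hp ↦ hp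
    refine isLocalDiffeomorphAt_graph hU' (by simpa using hq) hf (by exact_mod_cast le_top)
      (pair2EquivProd u v hD) ?_
    have hd : DifferentiableAt ℝ F (pathRot q).2 :=
      (hF.differentiableOn (by simp) _ hq).differentiableAt (hU.mem_nhds hq)
    have h := hasFDerivAt_of_partials hd hu hv
    rw [coe_pair2EquivProd]
    exact h
  have h3 := (pathOut nj yh t₀).isLocalDiffeomorph ((pathRot q).1, F (pathRot q).2)
  have h := (h1.comp (K := 𝓘(ℝ, (ℝ × ℝ) × (ℝ × ℝ))) (P := (ℝ × ℝ) × (ℝ × ℝ)) h2).comp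
    (K := 𝓘(ℝ, ℝ × ℝ × ℝ × ℝ)) (P := ℝ × ℝ × ℝ × ℝ) h3
  exact isLocalDiffeomorphAt_congr_nhds' h (Eventually.of_forall fun q' ↦ pathTubeMap_eq q')

/-- Smoothness of the tube for a smooth shell. [folklore] -/
theorem contDiffAt_pathTubeMap {q : ℝ × ℝ × ℝ × ℝ}
    (hF : ContDiffAt ℝ ∞ F (q.1, (rotAB q.2.1 q.2.2.1 q.2.2.2).1)) :
    ContDiffAt ℝ ∞ (pathTubeMap F nj yh t₀) q := by
  have h1 : ContDiff ℝ ∞ (pathRot : (ℝ × ℝ × ℝ × ℝ) → (ℝ × ℝ) × (ℝ × ℝ)) :=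
    contMDiff_iff_contDiff.1 pathRot.contMDiff
  have h3 : ContDiff ℝ ∞ (pathOut nj yh t₀ : ((ℝ × ℝ) × (ℝ × ℝ)) → ℝ × ℝ × ℝ × ℝ) :=
    contMDiff_iff_contDiff.1 (pathOut nj yh t₀).contMDiff
  have heq : pathTubeMap F nj yh t₀ = fun q ↦ pathOut nj yh t₀ ((pathRot q).1, F (pathRot q).2) :=
    funext pathTubeMap_eq
  rw [heq]
  refine h3.contDiffAt.comp q ((contDiffAt_fst.comp q h1.contDiffAt).prodMk ?_)
  exact hF.comp q (contDiffAt_snd.comp q h1.contDiffAt)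

/-- **Injectivity of the tube about the path** from injectivity of the shell on a set `S`:
equal tube points with shell arguments in `S` are equal. [folklore] -/
theorem pathTubeMap_inj {S : Set (ℝ × ℝ)} (hS : InjOn F S) {q q' : ℝ × ℝ × ℝ × ℝ}
    (hq : (q.1, (rotAB q.2.1 q.2.2.1 q.2.2.2).1) ∈ S) (hq' : (q'.1, (rotAB q'.2.1 q'.2.2.1 q'.2.2.2).1) ∈ S)
    (h : pathTubeMap F nj yh t₀ q = pathTubeMap F nj yh t₀ q') : q = q' := by
  simp only [pathTubeMap, Prod.mk.injEq, add_right_inj, sub_right_inj] at h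
  obtain ⟨hb, hY, hℓ, hX⟩ := h
  have hF : F (q.1, (rotAB q.2.1 q.2.2.1 q.2.2.2).1) = F (q'.1, (rotAB q'.2.1 q'.2.2.1 q'.2.2.2).1) := Prod.ext hX hY
  have hpa := hS hq hq' hF
  simp only [Prod.mk.injEq] at hpa
  obtain ⟨hpos, ha⟩ := hpa
  -- recover `(a, b)` from `(ã, b̃)` and `ℓ`
  have hab : (q.2.2.1, q.2.2.2) = (q'.2.2.1, q'.2.2.2) := by
    rw [← rotABInv_rotAB q.2.1 q.2.2.1 q.2.2.2, ← rotABInv_rotAB q'.2.1 q'.2.2.1 q'.2.2.2]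
    have hr : rotAB q.2.1 q.2.2.1 q.2.2.2 = rotAB q'.2.1 q'.2.2.1 q'.2.2.2 := Prod.ext ha hb
    rw [hr, hℓ]
  simp only [Prod.mk.injEq] at hab
  exact Prod.ext hpos (Prod.ext hℓ (Prod.ext hab.1 hab.2))

end Path

end Literature.Topology.FourManifolds
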